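import Summits.QuantumFields.YangMills.Theorems.BalabanUVNodesN13NormalisationCeilingOfCor3AtRecord13SepCoPHV
import Summits.QuantumFields.YangMills.Theorems.BalabanUVNodesN13WilsonPartitionFnGaussianUpperBoundSU
import Summits.QuantumFields.YangMills.Theorems.BalabanUVNodesN13NormalisationSlopeThresholdAtRecord13SepCoPHV

/-!
# BalabanUVNodes ∕ N13 — THE UPPER COUPLING-SLOPE THRESHOLD OF THE NORMALISATION: (B) at a revised record datum + endpoint existence REFUTE per-step inputs `logz`, `Efl` growing
# like `a·log(1∕g_j)·|T^{(j)*}|` with `a > d(𝔤)∕4`, modulo a displayed small-field floor and coupling comparability — the mirror of p640937; print's slope `d(𝔤)∕4` is the upper edge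

(Track A, DAG node N13 = [B16]; cluster K1 — K1⁹ `StabilityBRunRowsAtRecordR13SepCoPHV` = stmt-QuantumFields-27364, helper; seat `pub-ymgap-dag-n13-w3` g6, INTENT-4; 2026-08-28; count-neutral.)

THE PICTURE (LOCATED, count-neutral).  `E(P) = Σ_{j<K} [d(𝔤)·log g_j·|T^{(j)*}| + log σ₀·|T^{(j)*}| + ℓ_j]` with the LETTERS `ℓ_j := −logz_P(j)·(L⁴−1)|T₁^{(j+1)}| + Efl_P(j)`.  p640937 (g5): letters of
LOG-SLOPE AT MOST `a` with `2(1−L⁻⁴)(d(𝔤)−a) − (3∕2)d(𝔤) > 0` (i.e. `a` a hair below `d(𝔤)∕4`) are refuted by (B) + END, via LOWER Gaussian bounds on `log Z` and the window's upper half.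
THIS FILE: letters of LOG-SLOPE AT LEAST `a` with `4a > d(𝔤)` are refuted by (B) + END via the axial-tree UPPER Gaussian bound on `log Z` (p644908 + dag-n13-w1 g6's p644747, through
`…N13WilsonPartitionFnGaussianUpperBoundSU.log_linkMass_SU_le`) and the window's LOWER half (`…N13NormalisationCeilingOfCor3AtRecord13SepCoPHV`), MODULO two displayed hypotheses the
lower side did not need: (H_low) a K-UNIFORM SMALL-FIELD FLOOR at every small renormalised coupling: for each `g ∈ ]0,γ_c]` some `c(g) > 0` with `c(g) ≤ c_low(K) = smallFieldMass D K g₀` on every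
`γ_c`-windowed run `⟨K, F.m, g₀⟩` ending at `g_K = g` (the integrated lower leaf of (2.50) at the last step, uniform in the cutoff — N13's own lower content, NOT discharged here), and (H_cmp) COUPLING COMPARABILITY `log g₀ − M′ ≤ log g_j` (`j ≤ K`) on `γ_c`-windowed runs (the couplings do not DEcrease along the
run by more than `e^{M′}`; K1⁹'s row (iv) with (0.20) gives it with `M′ = M∕2` — the sequel derives it there).  Together with p640937 the admissible slope band of a (B)-carrying,
END-compatible witness is `[d(𝔤)(1−4L⁻⁴)∕(4(1−L⁻⁴)), d(𝔤)∕4]`; print's `log z_j = d(𝔤) log g_j + O(1)` ([I] (0.15); two-sided in the tree: `B16ZLower` + p644747) has slope EXACTLY `d(𝔤)∕4`,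
the band's upper edge — consistent, and not touched by this theorem (`4a > d(𝔤)` is strict).
* §1 `EOfRecord₁₃_ge_of_logSlopeLower` — along a γ-windowed run (`γ ≤ 1`) with (H_cmp): `E(P) ≥ 4(d(𝔤)−a)|T₁^{(0)}|·log g₀ − 4((d(𝔤)−a)M′ + |log σ₀| + C_w)|T₁^{(0)}|`.
* §2 ★★★ `false_of_endStatementBPrinted_of_endpointExistence_of_logSlopeLower` — `a ≤ d(𝔤) < 4a`, `0 ≤ C_w, M′`; letters of slope ≥ `a` + (H_cmp) + (H_low) + (B)(datumⱽ) + END ⟹ `False`.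
  ROAD: END gives (`γ ≤ e^{−2C∕κ′}`, `κ′ = 4a − d(𝔤)`) a target `g` and for EVERY `K` a run in `]0,γ]` ending at `g`; §1 below vs the ceiling + one-plaquette bound above, with
  `|T₁^{(0)}| = n_K·L^{4K}`, `n ≥ K`, `L^{4K} ≥ K`: for `K ≥ max(6d∕κ′, 2|R(g)|)` this reads `(κ′∕2)X ≤ C − ½` against `(κ′∕2)X ≥ C` (`X = log g₀⁻¹`).
* §3 `logCoupling_comparable_of_runPartialSumFloor` — (H_cmp) with `M′ = max(M,0)∕2` along every windowed run of the datum from K1⁹'s row (iv) `−M ≤ Σ_{j∈[k,n)} β_θ,j` VERBATIM (the datum's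
  runs solve (0.20): `FlowStepRuns.rgEqH_of_inInterval` on its `fwd ∕ curries` fields + `RGMachineCore.haltsOutside`; then `inv_sq_telescopeH`).  The cone sequel feeds §2 with §3 and END from K2⁹.
* §4 ★★★ `slope_band_of_endStatementBPrinted_of_endpointExistence` — TWO-SIDED letters of slope `a` (`|ℓ_j − a·log(1∕g_j)|T^{(j)*}|| ≤ C_w|T^{(j)*}|`) + (H_cmp) + (H_low) + (B) + END ⟹
  `2(1−L⁻⁴)(d−a) ≤ (3∕2)d ∧ 4a ≤ d`, i.e. `a ∈ [d(1−4L⁻⁴)∕(4(1−L⁻⁴)), d∕4]` (p640937 for the lower edge, §2 for the upper).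
HONEST FRAMING: count-neutral; nothing of Bałaban's asserted or refuted — the excluded classes are the TREE's numerics slots with super-print slope, under displayed (H_low), (H_cmp); K1⁹ NEITHER
proved NOR refuted; no skeleton ∕ route text changed; N13 NOT discharged; counts UNMOVED (typed 28∕28 · discharged 5∕27 · A 5∕28); R4 closes the conditional finite-𝕋⁴ rung `BalabanLadder.UV` only
— the Yang–Mills mass gap (Clay) is NOT proved by any of this; nothing continuum ∕ ℝ⁴ ∕ OS.  No `sorry`, `def`, `instance`, `notation`.
-/

noncomputable section

open MeasureTheory
open scoped BigOperators

namespace Summit.QuantumFields.YangMills.BalabanUVNodes.N13NormalisationUpperSlopeThresholdAtRecord13SepCoPHV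

open Literature.MathematicalPhysics.QuantumFieldTheory (haarProbability)
open Literature.MathematicalPhysics.QuantumFieldTheory.UnitaryCayley (haarChartConst)
open Literature.MathematicalPhysics.QuantumFieldTheory.Balaban1983to89
open Literature.MathematicalPhysics.QuantumFieldTheory.Balaban1983to89.T4Continuum
open Literature.MathematicalPhysics.QuantumFieldTheory.Balaban1983to89.Node00
open Literature.MathematicalPhysics.QuantumFieldTheory.Balaban1983to89.FlowStepRuns (genSeq genSeq_zero)
open Missing T4StabilitySocket
open Summit.QuantumFields.BalabanUV.T4Continuum.NE7b.BarePartitionFnDecay (linkMass)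
open Summit.QuantumFields.YangMills.BalabanUVNodes.N13UV01LevelZeroAtRecord13 (tstarCount_P_nonneg sum_tstarCount_P_range_le)
open Summit.QuantumFields.YangMills.BalabanUVNodes.N13NormalisationNoGoCouplingBlindAtRecord13SepCoPHV (dimSU_cast card_site_zero_eq card_site_top_pos le_L_pow)
open Summit.QuantumFields.YangMills.BalabanUVNodes.N13NormalisationSlopeThresholdAtRecord13SepCoPHV (le_sitesPerDir_zero)
open Summit.QuantumFields.YangMills.BalabanUVNodes.N13NormalisationCeilingOfCor3AtRecord13SepCoPHV (EOfRecord₁₃_le_linkMassCeiling_of_cor3With)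
open Summit.QuantumFields.YangMills.BalabanUVNodes.N13WilsonPartitionFnGaussianUpperBoundSU (log_linkMass_SU_le)
open Summit.QuantumFields.YangMills.BalabanUVNodes.N13ZNormLaplaceUpperSU (one_le_DT)

variable {F : T4Family} {N : ℕ} [NeZero N]

/-! ## §1. `E(P)` of a witness with letters of slope at least `a`, along a windowed run with comparable couplings -/

section EBound

variable (θ : Stage13Params F N) (P : B12.RunParams)

/-- **`E(P)` BELOW-BOUNDED FOR LETTERS OF SLOPE AT LEAST `a` ALONG A γ-WINDOWED RUN WITH COMPARABLE COUPLINGS** (`0 < g_j ≤ γ ≤ 1`, `a ≤ d(𝔤)`, `0 ≤ C_w`, `0 ≤ M′`):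
if for `j < K` `(a·(−log g_j) − C_w)·|T^{(j)*}| ≤ −logz_j·(L⁴−1)|T₁^{(j+1)}| + Efl_j` and `log g₀ − M′ ≤ log g_j` for `j ≤ K`, then
`4(d(𝔤) − a)·|T₁^{(0)}|·log g₀ − 4((d(𝔤) − a)M′ + |log σ₀| + C_w)·|T₁^{(0)}| ≤ E(P)` (`Σ_{j<K}|T^{(j)*}| ≤ 4|T₁^{(0)}|`).
[cite: Balaban1988Convergent, (1.15) p.249, Thm 1 p.262 (the shape of `E`; bookkeeping); Balaban1987RG1, (0.15) p.254] -/
theorem EOfRecord₁₃_ge_of_logSlopeLower {a Cw M' : ℝ} (ha : a ≤ ((dimSU N : ℕ) : ℝ)) (hCw : 0 ≤ Cw) (hM' : 0 ≤ M')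
    (hw : ∀ j, j < P.K → 0 < gOfRecord₁₃ F N θ P j → gOfRecord₁₃ F N θ P j ≤ 1 →
      (a * (-Real.log (gOfRecord₁₃ F N θ P j)) - Cw) * tstarCount (F.P P.K) j ≤
        -(θ.logz P j) * ((((F.P P.K).L : ℝ) ^ 4 - 1) * sitesCard (F.P P.K) (j + 1)) + θ.Efl P j)
    (hcmp : ∀ j, j ≤ P.K → Real.log P.g0 - M' ≤ Real.log (gOfRecord₁₃ F N θ P j))
    {γ : ℝ} (hγ : γ ≤ 1) (hI : ∀ k, k ≤ P.K → 0 < gOfRecord₁₃ F N θ P k ∧ gOfRecord₁₃ F N θ P k ≤ γ) :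
    4 * (((dimSU N : ℕ) : ℝ) - a) * (Fintype.card (Site (F.P P.K) 0) : ℝ) * Real.log P.g0
        - 4 * ((((dimSU N : ℕ) : ℝ) - a) * M' + |θ.ν.logσ₀| + Cw) * (Fintype.card (Site (F.P P.K) 0) : ℝ) ≤
      EOfRecord₁₃ F N θ P := by
  have hE : EOfRecord₁₃ F N θ P = ∑ j ∈ Finset.range P.K, eStepOfRecord N θ.ν (θ.Efl P) (θ.logz P) (gOfRecord₁₃ F N θ P) (F.P P.K) j := rfl
  set d : ℝ := ((dimSU N : ℕ) : ℝ) with hd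
  have hda : 0 ≤ d - a := by linarith
  have hlog0 : Real.log P.g0 ≤ 0 := by
    have hg := hI 0 (Nat.zero_le _)
    rw [show gOfRecord₁₃ F N θ P 0 = P.g0 from genSeq_zero _ _] at hg
    exact Real.log_nonpos hg.1.le (hg.2.trans hγ)
  -- per-step lower bound with the constant coefficient `c := (d − a)(log g₀ − M′) − (|log σ₀| + C_w) ≤ 0`
  set c : ℝ := (d - a) * (Real.log P.g0 - M') - (|θ.ν.logσ₀| + Cw) with hc
  have hc0 : c ≤ 0 := by
    have h1 : (d - a) * (Real.log P.g0 - M') ≤ 0 := mul_nonpos_of_nonneg_of_nonpos hda (by linarith)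
    have h2 : 0 ≤ |θ.ν.logσ₀| + Cw := by positivity
    linarith
  have hstep : ∀ j ∈ Finset.range P.K, c * tstarCount (F.P P.K) j ≤
      eStepOfRecord N θ.ν (θ.Efl P) (θ.logz P) (gOfRecord₁₃ F N θ P) (F.P P.K) j := by
    intro j hj
    have hjK : j < P.K := Finset.mem_range.mp hj
    have hg := hI j hjK.le
    have hT : 0 ≤ tstarCount (F.P P.K) j := tstarCount_P_nonneg (F := F) (by simp; omega)
    have hwj := hw j hjK hg.1 (hg.2.trans hγ)
    have hcj := hcmp j hjK.le
    have hσ : -|θ.ν.logσ₀| * tstarCount (F.P P.K) j ≤ θ.ν.logσ₀ * tstarCount (F.P P.K) j :=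
      mul_le_mul_of_nonneg_right (neg_abs_le _) hT
    have hdl : (d - a) * (Real.log P.g0 - M') * tstarCount (F.P P.K) j ≤ (d - a) * Real.log (gOfRecord₁₃ F N θ P j) * tstarCount (F.P P.K) j :=
      mul_le_mul_of_nonneg_right (mul_le_mul_of_nonneg_left hcj hda) hT
    unfold eStepOfRecord
    rw [← hd, hc]
    nlinarith [hwj, hσ, hdl, hT]
  rw [hE]
  refine le_trans ?_ (Finset.sum_le_sum hstep)
  rw [← Finset.mul_sum]
  have hS := sum_tstarCount_P_range_le (F := F) P.K P.K
  have hcS : c * (4 * (Fintype.card (Site (F.P P.K) 0) : ℝ)) ≤ c * ∑ j ∈ Finset.range P.K, tstarCount (F.P P.K) j :=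
    mul_le_mul_of_nonpos_left hS hc0
  refine le_trans (le_of_eq ?_) hcS
  rw [hc]; ring

end EBound

/-! ## §2. The upper slope threshold -/

section NoGo

variable (θ : Stage13HParams F N) (h : θ.Provisos₁₃SepCoPH F N) (v : Revision₁₃ F N θ h)

/-- **★★★ THE UPPER SLOPE THRESHOLD.**  Let `d = d(𝔰𝔲(N))`, `a ≤ d < 4a`, `0 ≤ C_w, M′`.  Suppose the witness's numerics slots have LOG-SLOPE AT LEAST `a` in the weak-coupling regime
(`∀ p j, j < p.K → 0 < g_j ≤ 1 → (a·(−log g_j) − C_w)|T^{(j)*}| ≤ −logz_p(j)·(L⁴−1)|T₁^{(j+1)}| + Efl_p(j)`, `g_j = gOfRecord₁₃ θ p j`), that its couplings are COMPARABLE along `γ_c`-windowed runs, some `γ_c > 0`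
(`log g₀ − M′ ≤ log g_j`, `j ≤ p.K`), and that for every renormalised coupling `g ∈ ]0,γ_c]` the small-field mass at the last step of the `γ_c`-windowed runs `⟨K, F.m, g₀⟩` ending at `g_K = g` has a K-UNIFORM FLOOR `c(g) > 0`.
Then (B) at the revised datum and endpoint existence are JOINTLY CONTRADICTORY.  LOCATED: (H_low) and (H_cmp) are displayed, not discharged; print's slope `d∕4` is NOT excluded.
[cite: Balaban1988Convergent, Thm 1 p.262, (1.15) p.249, Cor. 3 (2.50) p.264; Balaban1987RG1, Thm 2 p.259, (0.15) p.254] -/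
theorem false_of_endStatementBPrinted_of_endpointExistence_of_logSlopeLower {a Cw M' γc : ℝ} (ha : a ≤ ((dimSU N : ℕ) : ℝ)) (hκ : ((dimSU N : ℕ) : ℝ) < 4 * a)
    (hCw : 0 ≤ Cw) (hM' : 0 ≤ M') (hγc : 0 < γc)
    (hw : ∀ (p : B12.RunParams) (j : ℕ), j < p.K → 0 < gOfRecord₁₃ F N θ.toStage13Params p j → gOfRecord₁₃ F N θ.toStage13Params p j ≤ 1 →
      (a * (-Real.log (gOfRecord₁₃ F N θ.toStage13Params p j)) - Cw) * tstarCount (F.P p.K) j ≤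
        -(θ.logz p j) * ((((F.P p.K).L : ℝ) ^ 4 - 1) * sitesCard (F.P p.K) (j + 1)) + θ.Efl p j)
    (hcmp : ∀ p : B12.RunParams, (∀ k, k ≤ p.K → 0 < gOfRecord₁₃ F N θ.toStage13Params p k ∧ gOfRecord₁₃ F N θ.toStage13Params p k ≤ γc) →
      ∀ j, j ≤ p.K → Real.log p.g0 - M' ≤ Real.log (gOfRecord₁₃ F N θ.toStage13Params p j))
    (hlow : ∀ g : ℝ, 0 < g → g ≤ γc → ∃ c : ℝ, 0 < c ∧ ∀ (K : ℕ) (g₀ : ℝ),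
      (∀ k, k ≤ K → 0 < gOfRecord₁₃ F N θ.toStage13Params ⟨K, F.m, g₀⟩ k ∧ gOfRecord₁₃ F N θ.toStage13Params ⟨K, F.m, g₀⟩ k ≤ γc) →
        gOfRecord₁₃ F N θ.toStage13Params ⟨K, F.m, g₀⟩ K = g → c ≤ smallFieldMass (datumOfRecord₁₃SepCoPHV F N θ h v) K g₀)
    (hB : B16.EndStatementBPrinted (datumOfRecord₁₃SepCoPHV F N θ h v).C)
    (hE : DagBinding.EndpointExistence (datumOfRecord₁₃SepCoPHV F N θ h v).C.toB12) : False := by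
  obtain ⟨-, γB, hγB, em, ep, hcor⟩ := hB
  obtain ⟨γ₂, hγ₂, hend⟩ := hE F.m
  set d : ℝ := ((dimSU N : ℕ) : ℝ) with hddef
  have hda : 0 ≤ d - a := by rw [hddef]; linarith
  set κ : ℝ := 4 * a - d with hκdef
  have hκ0 : 0 < κ := by rw [hκdef, hddef]; linarith
  have hdnn : 0 ≤ d := Nat.cast_nonneg _
  -- the one-plaquette constant `log(D_N T_N) ≥ 0`
  set cDT : ℝ := Real.log (max (Real.pi * (haarChartConst N : ℝ) * 5 ^ (N * N) * (volume (Metric.closedBall (0 : EuclideanSpace ℝ (Fin N × Fin N)) 1)).toReal) (10 ^ (N * N - 1))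
          * (∑' k : ℕ, ((k : ℝ) + 1) ^ (N * N - 1) * Real.exp (-(1 / (2 * (N : ℝ)))) ^ k)) with hcDT
  have hcDT0 : 0 ≤ cDT := Real.log_nonneg one_le_DT
  set C₁ : ℝ := 4 * ((d - a) * M' + |θ.ν.logσ₀| + Cw) with hC₁
  have hC₁0 : 0 ≤ C₁ := by positivity
  set C : ℝ := C₁ + 3 * cDT + 1 with hCdef
  have hCpos : 0 < C := by positivity
  -- the window γ
  set γ : ℝ := min (min γB γ₂) (min (min 1 γc) (Real.exp (-(2 * C / κ)))) with hγdef
  have hγpos : 0 < γ := lt_min (lt_min hγB hγ₂) (lt_min (lt_min one_pos hγc) (Real.exp_pos _))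
  have hγB' : γ ≤ γB := (min_le_left _ _).trans (min_le_left _ _)
  have hγ1 : γ ≤ 1 := ((min_le_right _ _).trans (min_le_left _ _)).trans (min_le_left _ _)
  have hγc' : γ ≤ γc := ((min_le_right _ _).trans (min_le_left _ _)).trans (min_le_right _ _)
  have hγexp : γ ≤ Real.exp (-(2 * C / κ)) := (min_le_right _ _).trans (min_le_right _ _)
  obtain ⟨g, hgpos, hruns⟩ := hend γ hγpos ((min_le_left _ _).trans (min_le_right _ _))
  have hrun : ∀ K : ℕ, ∃ g0 : ℝ, ((datumOfRecord₁₃SepCoPHV F N θ h v).C ⟨K, F.m, g0⟩).flow.InInterval γ K ∧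
      ((datumOfRecord₁₃SepCoPHV F N θ h v).C ⟨K, F.m, g0⟩).flow.g K = g := fun K => hruns g hgpos le_rfl K
  have hgγ : g ≤ γ := by
    obtain ⟨g0, hI, hgK⟩ := hrun 0
    have := (hI 0 le_rfl).2
    rwa [hgK] at this
  have hg1 : g ≤ 1 := hgγ.trans hγ1
  -- the K-UNIFORM small-field floor at the endpoint `g`, and the `K`-independent remainder `R(g) = em(g) + |log c(g)|`
  obtain ⟨c, hcpos, hcK⟩ := hlow g hgpos (hgγ.trans hγc')
  set R : ℝ := em g + |Real.log c| with hRdef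
  -- per-`K` inequality, for `K ≥ 1` with `3d∕n ≤ κ∕2` and `|R| ≤ L^{4K}∕2`
  have hkey : ∀ K : ℕ, 1 ≤ K → 6 * d / κ ≤ ((F.P K).sitesPerDir 0 : ℝ) → 2 * |R| ≤ ((F.L : ℝ) ^ K) ^ 4 →
      κ / 2 * (2 * C / κ) ≤ C - 1 / 2 := by
    intro K hK hnKge hLK
    obtain ⟨g0, hI, hgK⟩ := hrun K
    have hflow : ((datumOfRecord₁₃SepCoPHV F N θ h v).C ⟨K, F.m, g0⟩).flow.g = gOfRecord₁₃ F N θ.toStage13Params ⟨K, F.m, g0⟩ :=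
      flow_g_datumOfRecord₁₃SepCoPHV F N θ h v ⟨K, F.m, g0⟩
    have hIc : ∀ k, k ≤ K → 0 < gOfRecord₁₃ F N θ.toStage13Params ⟨K, F.m, g0⟩ k ∧ gOfRecord₁₃ F N θ.toStage13Params ⟨K, F.m, g0⟩ k ≤ γc :=
      fun k hk => by have := hI k hk; rw [hflow] at this; exact ⟨this.1, this.2.trans hγc'⟩
    have hIγ : ∀ k, k ≤ K → 0 < gOfRecord₁₃ F N θ.toStage13Params ⟨K, F.m, g0⟩ k ∧ gOfRecord₁₃ F N θ.toStage13Params ⟨K, F.m, g0⟩ k ≤ γ :=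
      fun k hk => by have := hI k hk; rwa [hflow] at this
    have hgK' : gOfRecord₁₃ F N θ.toStage13Params ⟨K, F.m, g0⟩ K = g := by rw [← hflow]; exact hgK
    have hg0 : 0 < g0 ∧ g0 ≤ γ := by
      have := hIγ 0 (Nat.zero_le _)
      rwa [show gOfRecord₁₃ F N θ.toStage13Params ⟨K, F.m, g0⟩ 0 = g0 from genSeq_zero _ _] at this
    -- the small-field floor ⇒ `c_low > 0` and `log c ≤ log c_low`
    have hfloor := hcK K g0 hIc hgK'
    have hpos : 0 < smallFieldMass (datumOfRecord₁₃SepCoPHV F N θ h v) K g0 := lt_of_lt_of_le hcpos hfloor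
    have hlogc : Real.log c ≤ Real.log (smallFieldMass (datumOfRecord₁₃SepCoPHV F N θ h v) K g0) := Real.log_le_log hcpos hfloor
    -- §1: `E` below
    have hEge := EOfRecord₁₃_ge_of_logSlopeLower (F := F) θ.toStage13Params ⟨K, F.m, g0⟩ ha hCw hM'
      (fun j hj h0 h1 => hw ⟨K, F.m, g0⟩ j hj h0 h1) (hcmp ⟨K, F.m, g0⟩ hIc) hγ1 hIγ
    dsimp only at hEge
    -- the ceiling: `E` above
    have hEle := EOfRecord₁₃_le_linkMassCeiling_of_cor3With F N θ h v hcor K g0 (fun k hk => ⟨(hI k hk).1, (hI k hk).2.trans hγB'⟩) hpos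
    have hnum : ((datumOfRecord₁₃SepCoPHV F N θ h v).C ⟨K, F.m, g0⟩).numSites K = Fintype.card (Site (F.P K) K) := rfl
    rw [hgK, hnum] at hEle
    -- the one-plaquette bound at `β₀ = g₀⁻² > 0`
    have hβ0 : 0 < g0⁻¹ ^ 2 := pow_pos (inv_pos.2 hg0.1) 2
    have hlink := log_linkMass_SU_le N hβ0
    rw [← hcDT] at hlink
    have hlogβ : Real.log (g0⁻¹ ^ 2) = -2 * Real.log g0 := by rw [Real.log_pow, Real.log_inv]; ring
    rw [hlogβ, ← dimSU_cast (N := N), ← hddef] at hlink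
    -- `X = −log g₀ ≥ 2C∕κ`
    have hlogg0 : Real.log g0 ≤ -(2 * C / κ) := by
      have h1 : Real.log g0 ≤ Real.log γ := Real.log_le_log hg0.1 hg0.2
      have h2 : Real.log γ ≤ -(2 * C / κ) := by
        have := Real.log_le_log hγpos hγexp
        rwa [Real.log_exp] at this
      linarith
    -- atoms
    set T0 : ℝ := (Fintype.card (Site (F.P K) 0) : ℝ) with hT0
    set nK : ℝ := (Fintype.card (Site (F.P K) K) : ℝ) with hnKdef
    set n : ℝ := ((F.P K).sitesPerDir 0 : ℝ) with hn
    set X : ℝ := -Real.log g0 with hX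
    set L4 : ℝ := ((F.L : ℝ) ^ K) ^ 4 with hL4
    set ℓ : ℝ := Real.log (linkMass (G := SU N) (g0⁻¹ ^ 2)) with hℓ
    have hT0eq : T0 = nK * L4 := card_site_zero_eq (F := F) K
    have hnKpos : 0 < nK := card_site_top_pos (F := F) K
    have hL4K : (K : ℝ) ≤ L4 := le_L_pow (F := F) K
    have hL41 : 1 ≤ L4 := le_trans (by exact_mod_cast hK) hL4K
    have hT0nn : 0 ≤ T0 := Nat.cast_nonneg _
    have hn1 : (1 : ℝ) ≤ n := by rw [hn]; exact_mod_cast Nat.pos_of_ne_zero ((F.P K).sitesPerDir_ne_zero 0)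
    have hnpos : 0 < n := lt_of_lt_of_le one_pos hn1
    have hXge : 2 * C / κ ≤ X := by rw [hX]; linarith
    have hXnn : 0 ≤ X := le_trans (div_pos (by positivity) hκ0).le hXge
    -- the two bounds on `E`, combined: `4(d−a)·T0·(−X) − C₁T0 ≤ 3T0(1−1/n)ℓ + em g·nK − log c_low`
    have hnK1 : (1 : ℝ) ≤ nK := by rw [hnKdef]; exact_mod_cast Fintype.card_pos
    have hcomb : 4 * (d - a) * T0 * (-X) - C₁ * T0 ≤ 3 * T0 * (1 - 1 / n) * ℓ + em g * nK + |Real.log c| * nK := by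
      have h2 : 4 * (d - a) * T0 * Real.log g0 - 4 * ((d - a) * M' + |θ.ν.logσ₀| + Cw) * T0 ≤
          3 * T0 * (1 - 1 / n) * ℓ + em g * nK - Real.log (smallFieldMass (datumOfRecord₁₃SepCoPHV F N θ h v) K g0) := le_trans hEge hEle
      have h4 : |Real.log c| ≤ |Real.log c| * nK := le_mul_of_one_le_right (abs_nonneg _) hnK1
      rw [hC₁, hX]
      linarith [hlogc, neg_le_abs (Real.log c)]
    -- `ℓ ≤ −d·X + cDT` (one plaquette), with `0 ≤ 3T0(1−1/n)`
    have hℓ' : ℓ ≤ -(d * X) + cDT := by rw [hX]; linarith [hlink]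
    have hcoef : 0 ≤ 3 * T0 * (1 - 1 / n) := by
      have : 0 ≤ 1 - 1 / n := by rw [sub_nonneg, div_le_one hnpos]; exact hn1
      positivity
    have hcomb2 : 4 * (d - a) * T0 * (-X) - C₁ * T0 ≤ 3 * T0 * (1 - 1 / n) * (-(d * X) + cDT) + em g * nK + |Real.log c| * nK :=
      hcomb.trans (by linarith [mul_le_mul_of_nonneg_left hℓ' hcoef])
    -- `em g·nK + |log c|·nK = R·nK ≤ |R|·nK ≤ (L4/2)·nK = T0/2`
    have hRle : em g * nK + |Real.log c| * nK ≤ T0 / 2 := by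
      have h1 : em g * nK + |Real.log c| * nK = R * nK := by rw [hRdef]; ring
      rw [h1, hT0eq]
      have h2 : R * nK ≤ |R| * nK := mul_le_mul_of_nonneg_right (le_abs_self R) hnKpos.le
      have h3 : 2 * |R| * nK ≤ L4 * nK := mul_le_mul_of_nonneg_right hLK hnKpos.le
      linarith [h2, h3]
    -- `3T0(1−1/n)·cDT ≤ 3cDT·T0` and `3T0(1−1/n)(−dX) = −3dX·T0 + (3d/n)X·T0 ≤ −3dX·T0 + (κ/2)X·T0`
    have hninv0 : 0 ≤ 1 / n := by positivity
    have hc3 : 3 * T0 * (1 - 1 / n) * cDT ≤ 3 * cDT * T0 := by linarith [mul_nonneg hT0nn (mul_nonneg hninv0 hcDT0)]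
    have hdn : 3 * d * (1 / n) ≤ κ / 2 := by
      have h1 : 6 * d ≤ κ * n := by
        have := (div_le_iff₀ hκ0).1 hnKge
        linarith
      rw [mul_one_div, div_le_iff₀ hnpos]
      linarith
    have hmain : 3 * T0 * (1 - 1 / n) * (-(d * X)) ≤ -(3 * d * X * T0) + κ / 2 * X * T0 := by
      have e1 : 3 * T0 * (1 - 1 / n) * (-(d * X)) = -(3 * d * X * T0) + 3 * d * (1 / n) * (X * T0) := by ring
      rw [e1]
      linarith [mul_le_mul_of_nonneg_right hdn (mul_nonneg hXnn hT0nn)]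
    -- assemble: `(κ/2)·X·T0 ≤ (C − 1/2)·T0`
    have hfin : κ / 2 * X * T0 ≤ (C - 1 / 2) * T0 := by
      have e2 : 4 * (d - a) * T0 * (-X) = -(3 * d * X * T0) + κ * X * T0 := by rw [hκdef]; ring
      rw [e2] at hcomb2
      have e3 : 3 * T0 * (1 - 1 / n) * (-(d * X) + cDT) = 3 * T0 * (1 - 1 / n) * (-(d * X)) + 3 * T0 * (1 - 1 / n) * cDT := by ring
      rw [e3] at hcomb2
      rw [hCdef]
      linarith [hcomb2, hRle, hc3, hmain]
    -- divide by `T0 > 0`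
    have hT0pos : 0 < T0 := by rw [hT0eq]; exact mul_pos hnKpos (lt_of_lt_of_le one_pos hL41)
    have hfin' : κ / 2 * X ≤ C - 1 / 2 := le_of_mul_le_mul_right hfin hT0pos
    calc κ / 2 * (2 * C / κ) ≤ κ / 2 * X := mul_le_mul_of_nonneg_left hXge (by linarith)
      _ ≤ C - 1 / 2 := hfin'
  -- choose `K ≥ max(1, ⌈6d/κ⌉, ⌈2|R|⌉)`: `n ≥ K` and `L^{4K} ≥ K`
  obtain ⟨K, hK1, hKn, hKR⟩ : ∃ K : ℕ, 1 ≤ K ∧ 6 * d / κ ≤ (K : ℝ) ∧ 2 * |R| ≤ (K : ℝ) := by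
    refine ⟨max 1 (max ⌈6 * d / κ⌉₊ ⌈2 * |R|⌉₊), le_max_left _ _, ?_, ?_⟩
    · have h1 := Nat.le_ceil (6 * d / κ)
      have h2 : (⌈6 * d / κ⌉₊ : ℝ) ≤ ((max 1 (max ⌈6 * d / κ⌉₊ ⌈2 * |R|⌉₊) : ℕ) : ℝ) := by
        exact_mod_cast (le_max_left _ _).trans (le_max_right _ _)
      linarith
    · have h1 := Nat.le_ceil (2 * |R|)
      have h2 : (⌈2 * |R|⌉₊ : ℝ) ≤ ((max 1 (max ⌈6 * d / κ⌉₊ ⌈2 * |R|⌉₊) : ℕ) : ℝ) := by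
        exact_mod_cast (le_max_right _ _).trans (le_max_right _ _)
      linarith
  have h1 := hkey K hK1 (hKn.trans (le_sitesPerDir_zero (F := F) K)) (hKR.trans (le_L_pow (F := F) K))
  have hκne : κ ≠ 0 := hκ0.ne'
  have h2 : κ / 2 * (2 * C / κ) = C := by field_simp
  rw [h2] at h1
  linarith

end NoGo

/-! ## §3. (H_cmp) from a partial-sum floor on β (K1⁹'s row (iv)): the datum's windowed runs solve (0.20), so `−M ≤ Σ_{j<n} β_j` bounds `g_j⁻² ≤ g₀⁻² + M⁺` and `log g₀ − M⁺∕2 ≤ log g_j` -/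

section Comparability

variable (θ : Stage13HParams F N) (h : θ.Provisos₁₃SepCoPH F N) (v : Revision₁₃ F N θ h)

/-- **COUPLING COMPARABILITY FROM ROW (iv).**  If the partial sums of `β_θ := betaOfRecord₁₃ θ` along every (0.20)-run in `]0,γ₀]` are bounded below by `−M` (K1⁹'s row (iv), verbatim),
then along every run `p` of the (revised) record datum that stays in `]0,γ]`, `γ ≤ min(γ₀,1)`:  `log g₀ − max(M,0)∕2 ≤ log g_j` for all `j ≤ p.K` (`g_j = gOfRecord₁₃ θ p j`).
The datum's runs solve (0.20) (`FlowStepRuns.rgEqH_of_inInterval` on its `fwd ∕ curries` fields and `RGMachineCore.haltsOutside`), so `g_j⁻² = g₀⁻² − Σ_{i<j} β_i ≤ g₀⁻² + M⁺`, and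
`log(1 + M⁺g₀²) ≤ M⁺` (`g₀ ≤ 1`).  [cite: Balaban1987RG1, (0.18)–(0.20) pp.255–256 (bookkeeping)] -/
theorem logCoupling_comparable_of_runPartialSumFloor {γ₀ M : ℝ}
    (hiv : ∀ (n : ℕ) (gs : ℕ → ℝ), FlowStep.RGEqH n (betaOfRecord₁₃ F N θ.toStage13Params) gs → Step.InInterval γ₀ n gs →
      ∀ k, k ≤ n → -M ≤ ∑ j ∈ Finset.Ico k n, betaOfRecord₁₃ F N θ.toStage13Params j (FlowStep.prefixOf gs j))
    (p : B12.RunParams) {γ : ℝ} (hγ₀ : γ ≤ γ₀) (hγ1 : γ ≤ 1)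
    (hI : ((datumOfRecord₁₃SepCoPHV F N θ h v).C p).flow.InInterval γ p.K) :
    ∀ j, j ≤ p.K → Real.log p.g0 - max M 0 / 2 ≤ Real.log (gOfRecord₁₃ F N θ.toStage13Params p j) := by
  intro j hj
  have hhalt : FlowStepRuns.HaltsOutside (datumOfRecord₁₃SepCoPHV F N θ h v).C.toB12 (betaOfRecord₁₃ F N θ.toStage13Params) := by
    rw [toB12_datumOfRecord₁₃SepCoPHV]
    exact (coreOfRecord₁₃CoPH F N θ).haltsOutside (towerOfRecord₁₃SepCoPH F N θ h).ρ
  have hrg : FlowStep.RGEqH p.K (betaOfRecord₁₃ F N θ.toStage13Params) ((datumOfRecord₁₃SepCoPHV F N θ h v).C p).flow.g :=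
    FlowStepRuns.rgEqH_of_inInterval (datumOfRecord₁₃SepCoPHV F N θ h v).fwd hhalt (datumOfRecord₁₃SepCoPHV F N θ h v).curries p hI
  set gs : ℕ → ℝ := ((datumOfRecord₁₃SepCoPHV F N θ h v).C p).flow.g with hgs
  have hflow : gs = gOfRecord₁₃ F N θ.toStage13Params p := flow_g_datumOfRecord₁₃SepCoPHV F N θ h v p
  have hrgj : FlowStep.RGEqH j (betaOfRecord₁₃ F N θ.toStage13Params) gs := fun k hk => hrg k (lt_of_lt_of_le hk hj)
  have hIj : Step.InInterval γ₀ j gs := fun k hk => ⟨(hI k (hk.trans hj)).1, (hI k (hk.trans hj)).2.trans hγ₀⟩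
  have hsum := hiv j gs hrgj hIj 0 (Nat.zero_le _)
  have htel := FlowStep.inv_sq_telescopeH hrgj (Nat.zero_le j) le_rfl
  have hposj : 0 < gs j := (hI j hj).1
  have hpos0 : 0 < gs 0 := (hI 0 (Nat.zero_le _)).1
  have hle1 : gs 0 ≤ 1 := (hI 0 (Nat.zero_le _)).2.trans hγ1
  have hM0 : 0 ≤ max M 0 := le_max_right _ _
  have hinv : 1 / (gs j) ^ 2 ≤ 1 / (gs 0) ^ 2 + max M 0 := by linarith [le_max_left M 0]
  -- `1 ≤ A·g_j²`, `A := g₀⁻² + M⁺ ≤ (1 + M⁺)∕g₀²`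
  have hA : 0 < 1 / (gs 0) ^ 2 + max M 0 := by positivity
  have h1 : 1 ≤ (1 / (gs 0) ^ 2 + max M 0) * (gs j) ^ 2 := by
    have := (div_le_iff₀ (pow_pos hposj 2)).1 hinv
    linarith
  have h2 := Real.log_nonneg h1
  rw [Real.log_mul hA.ne' (pow_pos hposj 2).ne', Real.log_pow] at h2
  have hsq1 : (gs 0) ^ 2 ≤ 1 := by nlinarith
  have h3 : 1 / (gs 0) ^ 2 + max M 0 ≤ (1 + max M 0) / (gs 0) ^ 2 := by
    have hm : max M 0 ≤ max M 0 / (gs 0) ^ 2 := (le_div_iff₀ (pow_pos hpos0 2)).2 (mul_le_of_le_one_right hM0 hsq1)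
    rw [add_div]; linarith
  have h4 := Real.log_le_log hA h3
  rw [Real.log_div (by positivity) (pow_pos hpos0 2).ne', Real.log_pow] at h4
  have h5 : Real.log (1 + max M 0) ≤ max M 0 := by
    have := Real.log_le_sub_one_of_pos (by positivity : (0 : ℝ) < 1 + max M 0); linarith
  have hg0 : gs 0 = p.g0 := by rw [hflow]; exact genSeq_zero _ _
  have hgj : Real.log (gs j) = Real.log (gOfRecord₁₃ F N θ.toStage13Params p j) := by rw [hflow]
  rw [← hg0, ← hgj]
  push_cast at h2 h4
  linarith

end Comparability

/-! ## §4. The band: with p640937, two-sided letters of slope `a` force `d(𝔤)(1−4L⁻⁴)∕(4(1−L⁻⁴)) ≤ a ≤ d(𝔤)∕4` -/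

section Band

variable (θ : Stage13HParams F N) (h : θ.Provisos₁₃SepCoPH F N) (v : Revision₁₃ F N θ h)

/-- **★★★ THE NORMALISATION SLOPE BAND.**  If the witness's letters have TWO-SIDED log-slope `a` in the weak-coupling regime (`|ℓ_p(j) − a·log(1∕g_j)·|T^{(j)*}|| ≤ C_w|T^{(j)*}|`,
`0 ≤ a ≤ d(𝔤)`), the couplings are comparable and the last-step small-field mass has K-uniform floors along fixed-endpoint runs in some window `]0,γ_c]` (the hypotheses of §2), and
(B) holds at the revised datum together with endpoint existence, then `2(1−L⁻⁴)(d(𝔤)−a) ≤ (3∕2)d(𝔤)` (p640937: no smaller slope) AND `4a ≤ d(𝔤)` (§2: no larger slope) — i.e.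
`a ∈ [d(𝔤)(1−4L⁻⁴)∕(4(1−L⁻⁴)), d(𝔤)∕4]`; print's `log z_j = d(𝔤) log g_j + O(1)` ([I] (0.15)) has `a = d(𝔤)∕4`, the upper edge.  LOCATED; nothing asserted or refuted.
[cite: Balaban1988Convergent, Thm 1 p.262, (1.15) p.249, Cor. 3 (2.50) p.264; Balaban1987RG1, Thm 2 p.259, (0.15) p.254] -/
theorem slope_band_of_endStatementBPrinted_of_endpointExistence {a Cw M' γc : ℝ} (ha0 : 0 ≤ a) (ha : a ≤ ((dimSU N : ℕ) : ℝ))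
    (hCw : 0 ≤ Cw) (hM' : 0 ≤ M') (hγc : 0 < γc)
    (hw : ∀ (p : B12.RunParams) (j : ℕ), j < p.K → 0 < gOfRecord₁₃ F N θ.toStage13Params p j → gOfRecord₁₃ F N θ.toStage13Params p j ≤ 1 →
      |(-(θ.logz p j) * ((((F.P p.K).L : ℝ) ^ 4 - 1) * sitesCard (F.P p.K) (j + 1)) + θ.Efl p j) -
          a * (-Real.log (gOfRecord₁₃ F N θ.toStage13Params p j)) * tstarCount (F.P p.K) j| ≤ Cw * tstarCount (F.P p.K) j)
    (hcmp : ∀ p : B12.RunParams, (∀ k, k ≤ p.K → 0 < gOfRecord₁₃ F N θ.toStage13Params p k ∧ gOfRecord₁₃ F N θ.toStage13Params p k ≤ γc) →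
      ∀ j, j ≤ p.K → Real.log p.g0 - M' ≤ Real.log (gOfRecord₁₃ F N θ.toStage13Params p j))
    (hlow : ∀ g : ℝ, 0 < g → g ≤ γc → ∃ c : ℝ, 0 < c ∧ ∀ (K : ℕ) (g₀ : ℝ),
      (∀ k, k ≤ K → 0 < gOfRecord₁₃ F N θ.toStage13Params ⟨K, F.m, g₀⟩ k ∧ gOfRecord₁₃ F N θ.toStage13Params ⟨K, F.m, g₀⟩ k ≤ γc) →
        gOfRecord₁₃ F N θ.toStage13Params ⟨K, F.m, g₀⟩ K = g → c ≤ smallFieldMass (datumOfRecord₁₃SepCoPHV F N θ h v) K g₀)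
    (hB : B16.EndStatementBPrinted (datumOfRecord₁₃SepCoPHV F N θ h v).C)
    (hE : DagBinding.EndpointExistence (datumOfRecord₁₃SepCoPHV F N θ h v).C.toB12) :
    2 * (1 - ((F.L : ℝ) ^ 4)⁻¹) * (((dimSU N : ℕ) : ℝ) - a) ≤ 3 / 2 * ((dimSU N : ℕ) : ℝ) ∧ 4 * a ≤ ((dimSU N : ℕ) : ℝ) := by
  have hup : ∀ (p : B12.RunParams) (j : ℕ), j < p.K → 0 < gOfRecord₁₃ F N θ.toStage13Params p j → gOfRecord₁₃ F N θ.toStage13Params p j ≤ 1 →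
      -(θ.logz p j) * ((((F.P p.K).L : ℝ) ^ 4 - 1) * sitesCard (F.P p.K) (j + 1)) + θ.Efl p j ≤
        (a * (-Real.log (gOfRecord₁₃ F N θ.toStage13Params p j)) + Cw) * tstarCount (F.P p.K) j := by
    intro p j hj h0 h1
    have := (abs_le.1 (hw p j hj h0 h1)).2
    linarith
  have hdown : ∀ (p : B12.RunParams) (j : ℕ), j < p.K → 0 < gOfRecord₁₃ F N θ.toStage13Params p j → gOfRecord₁₃ F N θ.toStage13Params p j ≤ 1 →
      (a * (-Real.log (gOfRecord₁₃ F N θ.toStage13Params p j)) - Cw) * tstarCount (F.P p.K) j ≤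
        -(θ.logz p j) * ((((F.P p.K).L : ℝ) ^ 4 - 1) * sitesCard (F.P p.K) (j + 1)) + θ.Efl p j := by
    intro p j hj h0 h1
    have := (abs_le.1 (hw p j hj h0 h1)).1
    linarith
  refine ⟨?_, ?_⟩
  · by_contra hκ
    push Not at hκ
    exact N13NormalisationSlopeThresholdAtRecord13SepCoPHV.false_of_endStatementBPrinted_of_endpointExistence_of_logSlope θ h v ha0 ha hCw
      (by linarith) hup hB hE
  · by_contra hκ
    push Not at hκ
    exact false_of_endStatementBPrinted_of_endpointExistence_of_logSlopeLower θ h v ha hκ hCw hM' hγc hdown hcmp hlow hB hE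

end Band

end Summit.QuantumFields.YangMills.BalabanUVNodes.N13NormalisationUpperSlopeThresholdAtRecord13SepCoPHV

end
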